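import Literature.NumberTheory.Automorphic.SatakeParametersModP
import Mathlib.RingTheory.Polynomial.Vieta
import HarnessLib

/-!
# Satake parameters mod `p` through the Hecke eigenvalues: `α` is the parameter of `θ` iff
# `θ(T_r) = q^{-r(r-1)/2} e_r(α)` for `r ≤ n`; the parameters are the roots of the Hecke polynomial
# `∑_r (-1)^r q^{r(r-1)/2} θ(T_r) X^{n-r}` (Tamagawa; Shimura Thm. 3.21; Macdonald Ch. V (3.2)–(3.3))

Topic `NumberTheory/Automorphic`; namespace `Literature.NumberTheory.Automorphic` (lane `lit-hodgefound`, Track 2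
foundations; seat `lit-hodgefound-p11`, generation 42, row g42-#11).  THEOREMS ONLY: no definition, no named fact, no
instance, no notation.  Sequel to g42-#5 (`SatakeParametersModP`): over ANY field `k` in which `q = #𝓀` is a unit (no
algebraic closure needed) and for every `F` with a `ValuativeRel` whose valuation ring is a DVR with finite residue field,
a multiset `α` of `n` units of `k` is the Satake parameter of the character `θ : ℋ_k(GL_n(F), GL_n(𝒪)) → k` (tree predicate
`IsSatakeParameterModP`, i.e. `θ = ev_a ∘ 𝒮_k`) **iff** its elementary symmetric functions are the renormalised Hecke
eigenvalues, `e_r(α) = q^{r(r-1)/2} θ(T_r)` (`1 ≤ r ≤ n`) — the «if» direction because a character is determined by its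
values on the `T_r` (g42-#4); hence the parameter is the multiset of roots of the HECKE POLYNOMIAL
`∏_{a ∈ α} (X - a) = ∑_{r=0}^{n} (-1)^r q^{r(r-1)/2} θ(T_r) X^{n-r}`.

## The print

[ShimuraIATAF1971] Thm. 3.21: «`∑_{k=0}^∞ T(p^k) X^k = [∑_{r=0}^{n} (-1)^r p^{r(r-1)/2} T_r^{(n)} X^r]^{-1}`» (Tamagawa's
rationality; the denominator is the Hecke polynomial, whose reciprocal roots under a character are the Satake parameters in
the integral normalisation); [Macdonald1995] Ch. V §3 (3.2)–(3.3) («`ω̂_s` is the composition of `θ` with the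
specialization `x_i ↦ z_i`»; the characters are parametrised by the unordered `n`-tuples `z`); [CartierCorvallis1979] §IV
Cor. 4.2.  With the integral normalisation of the tree (`satakeTransformModP`: `𝒮(T_r) = q^{-r(r-1)/2} e_r(x)`,
`satakeTransformModP_doubleCosetOperator_heckeDiag`).

## What is formalised (theorems only)

* **`isSatakeParameterModP_iff_forall_apply_heckeDiag`**: `IsSatakeParameterModP hϖ hq θ α ↔ card α = n ∧ ∀ r ≤ n,
  θ(T_r) = q^{-r(r-1)/2} e_r(α)` (any field `k` with `q ∈ kˣ`).
* `IsSatakeParameterModP.esymm_eq` (`e_r(α) = q^{r(r-1)/2} θ(T_r)`),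
  **`IsSatakeParameterModP.prod_X_sub_C_eq`** (the Hecke polynomial: `∏_{a ∈ α} (X - a) =
  ∑_{r ≤ n} (-1)^r q^{r(r-1)/2} θ(T_r) X^{n-r}`), `IsSatakeParameterModP.isRoot_iff` (`a` is a root of the Hecke polynomial
  iff `a ∈ α`).

## References
* [ShimuraIATAF1971] G. Shimura, *Introduction to the Arithmetic Theory of Automorphic Functions* (1971), Thm. 3.21.
* [Macdonald1995] I. G. Macdonald, *Symmetric Functions and Hall Polynomials*, 2nd ed. (1995), Ch. V §3 (3.2)–(3.3) (PDF p. 248).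
* [CartierCorvallis1979] P. Cartier, *Representations of 𝔭-adic groups: a survey*, PSPM 33.1 (1979), §IV Cor. 4.2.
-/

noncomputable section

open scoped MatrixGroups Pointwise
open ValuativeRel Matrix Finset MonoidAlgebra Representation MulAction Polynomial

namespace Literature.NumberTheory.Automorphic

section HeckePolynomial

variable {F : Type*} [Field F] [ValuativeRel F] {n : ℕ} [IsDiscreteValuationRing 𝒪[F]] [Finite 𝓀[F]] {ϖ : F}
  {k : Type*} [Field k] (hϖ : IsUniformizingElement ϖ) (hq : IsUnit ((Nat.card 𝓀[F] : ℕ) : k))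
  [IsHeckeTriple (⊤ : Submonoid (GL (Fin n) F)) (glInt n F) (glInt n F)]

/-- **SATAKE PARAMETERS THROUGH HECKE EIGENVALUES** (any field `k` with `q ∈ kˣ`, no algebraic closure): a multiset `α`
of units of `k` is the Satake parameter of the character `θ` iff `#α = n` and `θ(T_r) = q^{-r(r-1)/2} e_r(α)` for all
`r ≤ n`.  (⇒: `IsSatakeParameterModP.apply_doubleCosetOperator_heckeDiag`; ⇐: the character `ev_a ∘ 𝒮_k` of an
enumeration `a` of `α` has these eigenvalues, and a character is determined by its values on the `T_r`, g42-#4.)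
[cite: Macdonald1995, Ch. V §3 (3.2)–(3.3)] [cite: ShimuraIATAF1971, Thm. 3.21] [cite: CartierCorvallis1979, §IV Cor. 4.2] -/
theorem isSatakeParameterModP_iff_forall_apply_heckeDiag (θ : heckeAlgebra k (GL (Fin n) F) (glInt n F) →ₐ[k] k)
    (α : Multiset kˣ) :
    IsSatakeParameterModP hϖ hq θ α ↔ Multiset.card α = n ∧ ∀ r ≤ n,
      θ (heckeAlgebra.doubleCosetOperator (glInt n F) (heckeDiag n (Units.mk0 ϖ hϖ.ne_zero) r)) =
        ((hq.unit⁻¹ ^ (r * (r - 1) / 2) : kˣ) : k) * (α.map (Units.val : kˣ → k)).esymm r := by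
  constructor
  · exact fun h => ⟨h.card_eq, fun r hr => h.apply_doubleCosetOperator_heckeDiag hr⟩
  · rintro ⟨hcard, h⟩
    obtain ⟨a, rfl⟩ := exists_fun_univ_val_map_eq α hcard
    have hθ : θ = (laurentEval a).comp (satakeTransformModP hϖ hq) := by
      refine algHom_heckeAlgebra_glInt_ext_of_commRing hϖ fun r => ?_
      rw [zpowDiagGL_indicator_le_eq_heckeDiag, h _ (Nat.succ_le_of_lt r.isLt),
        (isSatakeParameterModP_comp hϖ hq a).apply_doubleCosetOperator_heckeDiag (Nat.succ_le_of_lt r.isLt)]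
    rw [hθ]
    exact isSatakeParameterModP_comp hϖ hq a

variable {hϖ hq} {θ : heckeAlgebra k (GL (Fin n) F) (glInt n F) →ₐ[k] k} {α : Multiset kˣ}

/-- **`e_r(α) = q^{r(r-1)/2} θ(T_r)`** (`r ≤ n`) for the Satake parameter `α` of `θ`. [cite: ShimuraIATAF1971, Thm. 3.21]
[cite: Macdonald1995, Ch. V §3 (3.3)] -/
theorem IsSatakeParameterModP.esymm_eq (h : IsSatakeParameterModP hϖ hq θ α) {r : ℕ} (hr : r ≤ n) :
    (α.map (Units.val : kˣ → k)).esymm r =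
      ((hq.unit ^ (r * (r - 1) / 2) : kˣ) : k) *
        θ (heckeAlgebra.doubleCosetOperator (glInt n F) (heckeDiag n (Units.mk0 ϖ hϖ.ne_zero) r)) := by
  rw [h.apply_doubleCosetOperator_heckeDiag hr, ← mul_assoc, ← Units.val_mul, inv_pow, mul_inv_cancel, Units.val_one, one_mul]

/-- **THE HECKE POLYNOMIAL**: for the Satake parameter `α` of `θ`,
`∏_{a ∈ α} (X - a) = ∑_{r=0}^{n} (-1)^r q^{r(r-1)/2} θ(T_r) X^{n-r}` in `k[X]` — the Satake parameters are the roots of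
Tamagawa's polynomial `X^n - θ(T_1) X^{n-1} + q θ(T_2) X^{n-2} - q^3 θ(T_3) X^{n-3} + ⋯` (Vieta).
[cite: ShimuraIATAF1971, Thm. 3.21] [cite: Macdonald1995, Ch. V §3 (3.2)–(3.3)] -/
theorem IsSatakeParameterModP.prod_X_sub_C_eq (h : IsSatakeParameterModP hϖ hq θ α) :
    (α.map fun a : kˣ => X - C (a : k)).prod =
      ∑ r ∈ Finset.range (n + 1), (-1) ^ r * (C (((hq.unit ^ (r * (r - 1) / 2) : kˣ) : k) *
        θ (heckeAlgebra.doubleCosetOperator (glInt n F) (heckeDiag n (Units.mk0 ϖ hϖ.ne_zero) r))) * X ^ (n - r)) := by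
  have hcard : Multiset.card (α.map (Units.val : kˣ → k)) = n := by rw [Multiset.card_map, h.card_eq]
  have h1 := Multiset.prod_X_sub_X_eq_sum_esymm (α.map (Units.val : kˣ → k))
  rw [Multiset.map_map, hcard] at h1
  rw [show (fun a : kˣ => X - C (a : k)) = (fun t : k => X - C t) ∘ (Units.val : kˣ → k) from rfl, h1]
  exact Finset.sum_congr rfl fun r hr => by rw [h.esymm_eq (Nat.lt_succ_iff.1 (Finset.mem_range.1 hr))]

/-- **The Satake parameters are exactly the roots of the Hecke polynomial**: a unit `a` of `k` is a root of
`∑_r (-1)^r q^{r(r-1)/2} θ(T_r) X^{n-r}` iff `a ∈ α`. [cite: ShimuraIATAF1971, Thm. 3.21] [cite: Macdonald1995, Ch. V §3 (3.2)] -/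
theorem IsSatakeParameterModP.isRoot_iff (h : IsSatakeParameterModP hϖ hq θ α) (a : kˣ) :
    (∑ r ∈ Finset.range (n + 1), (-1) ^ r * (C (((hq.unit ^ (r * (r - 1) / 2) : kˣ) : k) *
        θ (heckeAlgebra.doubleCosetOperator (glInt n F) (heckeDiag n (Units.mk0 ϖ hϖ.ne_zero) r))) * X ^ (n - r))).IsRoot
      (a : k) ↔ a ∈ α := by
  rw [← h.prod_X_sub_C_eq, Polynomial.IsRoot, Polynomial.eval_multiset_prod, Multiset.prod_eq_zero_iff, Multiset.map_map,
    Multiset.mem_map]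
  simp only [Function.comp_apply, eval_sub, eval_X, eval_C, sub_eq_zero]
  constructor
  · rintro ⟨b, hb, hab⟩
    rwa [Units.val_injective hab]
  · exact fun ha => ⟨a, ha, rfl⟩

end HeckePolynomial

end Literature.NumberTheory.Automorphic

end
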